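/-
Copyright: the b2b-balaban T⁴-continuum CRUX team, row NE7b OWNER lineage `t4-ne7b-p1` (gen 137). Project licence.
-/
import Summits.QuantumFields.BalabanUV.T4Continuum.Spine.NE7b.SupBlockLowerLetter

/-!
# THE TILTED GAUSSIAN LAW AS A LEBESGUE TILT ON `ℝⁿ` — THE TRANSFER DICTIONARY for the class-closure plan, item (d).  The step's tilted
# law `ν_ψ = Z(ψ)⁻¹e^{−U(ω+ψ)}dN(0,M⁻¹)(ω)` on `EuclideanSpace ℝ ι` is, after reindexing the sites by `Fin n` through a linear isometry
# `e : ℝ^ι ≃ₗᵢ ℝⁿ`, the Lebesgue tilt `e^{−V}dy∕∫e^{−V}` of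
#   `V(y) = U(e⁻¹y + ψ) + ½⟨e⁻¹y, M e⁻¹y⟩`:
# for EVERY `F`,  `∫ F(e⁻¹y)e^{−V(y)}dy = 𝒩_M·∫e^{−U(ω+ψ)}F(ω)dN(0,M⁻¹)(ω)`  (`𝒩_M = ∫e^{−½⟨z,Mz⟩}dz`), integrability transfers the same
# way, `e^{−V}` is integrable, and `V` is continuous, differentiable and — from the secant lower letter `λ` of `U` and the floor `m` of `M` —
# FIRST-ORDER `(m−λ)`-UNIFORMLY CONVEX:  `V(x) + ⟨∇V(x), y−x⟩ + ½(m−λ)‖y−x‖² ≤ V(y)` — verbatim the hypotheses of the tree's Brascamp–Lieb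
# variance inequality `Literature.Probability.Moments.variance_tilted_le` [cite: BrascampLieb1976, Thm 4.1], so that the successor file reads
# the Poincaré inequality of `ν_ψ` off it (row NE7b, node U5c; (401)'s Lebesgue–Gaussian dictionary BY NAME; [folklore])

Cell `pub-balaban`, sub-cell `t4`, spine estimate NE7b (`T4WeightBudget.RelWeightBound`; the cell's OWN estimate — NOT PRINTED in
[Bałaban 1983–89], NOT PROVED).  Crux-route work under `Spine/NE7b/` by the row OWNER (`t4-ne7b-p1` gen 137, file (421)) under FREEZE
(0)'s crux-prover clause (this gen's class-closure audit, item (d): the UNIFORM third-order letter needs log-concave concentration); NOTHING of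
Bałaban's is named as a Lean object, valued or asserted; no `T4Continuum/Support` leaf typed; no `def`, no notation (`V`, `e` are bound
variables ∕ written out); zero `sorry`.  Imports (BY NAME): the OWNER's (401) `…SupBlockLowerLetter` and through it (398), the tree's
`SupJointConvexity` (`quadForm_secant`, `firstOrder_of_secant_hasFDerivAt'`), `SupGaussianRegulator` (`transpose_eq_of_posSemidef`), the
Literature dictionary `B2Eq228Conditioning` (`gaussProb`, `integral_gaussProb`, `gaussProb_eq_map_multivariateGaussian`, `gaussNorm_pos`,
`gaussWeight_pos`, `measurable_gaussWeight_real`), `B13GaugeDevices` (`gaussWeight`, `gaussNorm`, `gaussMean`, `gaussInt`); Mathlib's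
`LinearIsometryEquiv.measurePreserving`, `PiLp.volume_preserving_toLp`, `MeasureTheory.integral_map_equiv`.

WHAT IS PROVED ([folklore]; `e : ℝ^ι ≃ₗᵢ ℝⁿ` any linear isometry, `V` as displayed):
* §1 `integral_fin_transfer` (`∫G(y)dy = ∫G(e x)dx`), `integral_euclid_transfer` (`∫H(x)dx = ∫H(toLp z)dz`), `integral_gaussWeight_mul`
  (`∫e^{−½zMz}h(z)dz = 𝒩_M∫h(ofLp ω)dN(0,M⁻¹)`), **`tilted_integral_transfer`** (the display), `tilted_integrable_transfer`,
  **`exp_neg_V_integrable`**, `integral_exp_neg_V` (`∫e^{−V} = 𝒩_M·Z(ψ)`);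
* §2 `V_continuous`, `quadForm_differentiable`, `V_hasFDerivAt`, `V_secant`, THE END **`V_firstOrder_convex`** (the first-order
  `(m−λ)`-convexity with Mathlib's `gradient`); §3 toy.

HONEST (what this is NOT).  Measure bookkeeping and one convexity inequality; the Poincaré inequality itself is read off the tree's Brascamp–Lieb
theorem in the successor file; no contraction ((β4)), no decaying-covariance polymer expansion ((β3′)); scalar skeleton ((A3), NC-NE7b-α
UNRULED); nothing of Bałaban's asserted.  BY-NAME EFFECT ON THE WALL: NONE.  NE7b NOT PRINTED ∕ NOT PROVED; spine PROVED 0∕9; rung (B)+1 — the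
programme's measures remain FINITE-torus statements; NOT the mass gap, NOT Clay.  HONEST DEPENDENCY: continuum YM on T⁴ ⇐ BetaPertH ∧ nine spine
estimates (0∕9 proved); BetaPertH ⇐ (D1) ∧ (D4) ∧ CAP+tail; G-an2-4 gates asym, D1 and NE2∕3∕4.
-/

set_option autoImplicit false

noncomputable section

namespace Summit.QuantumFields.BalabanUV.T4Continuum.NE7b.SupTiltedTransfer

open MeasureTheory ProbabilityTheory Finset Real
open scoped BigOperators ENNReal Matrix
open Literature.MathematicalPhysics.QuantumFieldTheory.Balaban1983to89
open B13GaugeDevices (gaussWeight gaussNorm gaussMean gaussInt)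
open B2Eq228Conditioning (gaussProb integral_gaussProb gaussProb_eq_map_multivariateGaussian gaussNorm_pos gaussWeight_pos
  measurable_gaussWeight_real)
open SupJointConvexity (quadForm_secant firstOrder_of_secant_hasFDerivAt')
open SupGaussianRegulator (transpose_eq_of_posSemidef)

variable {ι : Type} [Fintype ι] [DecidableEq ι] {n : ℕ}

/-! ## §1. The measure transfers -/

omit [DecidableEq ι] in
/-- **Reindexing**: `∫_{ℝⁿ}G(y)dy = ∫_{ℝ^ι}G(e x)dx` for a linear isometry `e` (Lebesgue measure is preserved). [folklore] -/
theorem integral_fin_transfer (e : EuclideanSpace ℝ ι ≃ₗᵢ[ℝ] EuclideanSpace ℝ (Fin n)) (G : EuclideanSpace ℝ (Fin n) → ℝ) :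
    ∫ y : EuclideanSpace ℝ (Fin n), G y = ∫ x : EuclideanSpace ℝ ι, G (e x) := by
  have hmp : MeasurePreserving (e.toHomeomorph.toMeasurableEquiv) volume volume := e.measurePreserving
  rw [← hmp.integral_comp']
  rfl

omit [DecidableEq ι] in
/-- **Coordinates**: `∫_{ℝ^ι}H(x)dx = ∫_{ι→ℝ}H(toLp z)dz`. [folklore] -/
theorem integral_euclid_transfer (H : EuclideanSpace ℝ ι → ℝ) :
    ∫ x : EuclideanSpace ℝ ι, H x = ∫ z : ι → ℝ, H (WithLp.toLp 2 z) := by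
  have hmp : MeasurePreserving (MeasurableEquiv.toLp 2 (ι → ℝ)) volume volume := PiLp.volume_preserving_toLp ι
  rw [← hmp.integral_comp']
  rfl

/-- **The Gaussian weight as a measure**: `∫e^{−½⟨z,Mz⟩}h(z)dz = 𝒩_M·∫h(ofLp ω)dN(0,M⁻¹)(ω)` (`M ≻ 0`). [folklore] -/
theorem integral_gaussWeight_mul {M : Matrix ι ι ℝ} (hM : M.PosDef) (h : (ι → ℝ) → ℝ) :
    ∫ z : ι → ℝ, gaussWeight M z * h z = gaussNorm M * ∫ ω : EuclideanSpace ℝ ι, h (WithLp.ofLp ω) ∂(multivariateGaussian 0 M⁻¹) := by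
  have hN := gaussNorm_pos hM
  have h1 : ∫ z : ι → ℝ, h z ∂(gaussProb M) = (gaussNorm M)⁻¹ * ∫ z : ι → ℝ, gaussWeight M z * h z := by
    rw [integral_gaussProb]
    simp only [gaussMean, gaussInt, smul_eq_mul]
  have h2 : ∫ z : ι → ℝ, h z ∂(gaussProb M) = ∫ ω : EuclideanSpace ℝ ι, h (WithLp.ofLp ω) ∂(multivariateGaussian 0 M⁻¹) := by
    rw [gaussProb_eq_map_multivariateGaussian hM, integral_map_equiv]
    rfl
  rw [← h2, h1, ← mul_assoc, mul_inv_cancel₀ hN.ne', one_mul]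

section Transfer

variable {M : Matrix ι ι ℝ} {U : EuclideanSpace ℝ ι → ℝ}

/-- **THE TILTED INTEGRAL TRANSFER**: with `V(y) = U(e⁻¹y + ψ) + ½⟨e⁻¹y, Me⁻¹y⟩`, for EVERY `F : ℝ^ι → ℝ`,
`∫F(e⁻¹y)e^{−V(y)}dy = 𝒩_M·∫e^{−U(ω+ψ)}F(ω)dN(0,M⁻¹)(ω)`. [folklore] -/
theorem tilted_integral_transfer (hM : M.PosDef) (e : EuclideanSpace ℝ ι ≃ₗᵢ[ℝ] EuclideanSpace ℝ (Fin n)) (ψ : EuclideanSpace ℝ ι)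
    (F : EuclideanSpace ℝ ι → ℝ) :
    ∫ y : EuclideanSpace ℝ (Fin n), F (e.symm y) *
        exp (-(U (e.symm y + ψ) + 1 / 2 * ((WithLp.ofLp (e.symm y)) ⬝ᵥ (M *ᵥ (WithLp.ofLp (e.symm y)))))) =
      gaussNorm M * ∫ ω : EuclideanSpace ℝ ι, exp (-U (ω + ψ)) * F ω ∂(multivariateGaussian 0 M⁻¹) := by
  rw [integral_fin_transfer e]
  simp only [LinearIsometryEquiv.symm_apply_apply]
  rw [integral_euclid_transfer]
  have e1 : ∀ z : ι → ℝ, F (WithLp.toLp 2 z) * exp (-(U (WithLp.toLp 2 z + ψ) + 1 / 2 * (z ⬝ᵥ (M *ᵥ z)))) =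
      gaussWeight M z * (exp (-U (WithLp.toLp 2 z + ψ)) * F (WithLp.toLp 2 z)) := fun z => by
    rw [neg_add, exp_add, gaussWeight]
    ring
  simp_rw [e1]
  rw [integral_gaussWeight_mul hM]

/-- **Integrability transfers the same way**: `e^{−U(·+ψ)}F` integrable for `N(0,M⁻¹)` ⟹ `y ↦ F(e⁻¹y)e^{−V(y)}` integrable on `ℝⁿ`. [folklore] -/
theorem tilted_integrable_transfer (hM : M.PosDef) (e : EuclideanSpace ℝ ι ≃ₗᵢ[ℝ] EuclideanSpace ℝ (Fin n)) (ψ : EuclideanSpace ℝ ι)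
    {F : EuclideanSpace ℝ ι → ℝ}
    (hF : Integrable (fun ω : EuclideanSpace ℝ ι => exp (-U (ω + ψ)) * F ω) (multivariateGaussian 0 M⁻¹)) :
    Integrable (fun y : EuclideanSpace ℝ (Fin n) => F (e.symm y) *
      exp (-(U (e.symm y + ψ) + 1 / 2 * ((WithLp.ofLp (e.symm y)) ⬝ᵥ (M *ᵥ (WithLp.ofLp (e.symm y))))))) := by
  have hN := gaussNorm_pos hM
  -- step 1: to `ℝ^ι`
  have hmp : MeasurePreserving (e.toHomeomorph.toMeasurableEquiv) volume volume := e.measurePreserving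
  rw [← hmp.integrable_comp_emb (e.toHomeomorph.toMeasurableEquiv).measurableEmbedding]
  have hfun : ((fun y : EuclideanSpace ℝ (Fin n) => F (e.symm y) *
      exp (-(U (e.symm y + ψ) + 1 / 2 * ((WithLp.ofLp (e.symm y)) ⬝ᵥ (M *ᵥ (WithLp.ofLp (e.symm y))))))) ∘
        (e.toHomeomorph.toMeasurableEquiv)) = fun x : EuclideanSpace ℝ ι => F x *
      exp (-(U (x + ψ) + 1 / 2 * ((WithLp.ofLp x) ⬝ᵥ (M *ᵥ (WithLp.ofLp x))))) := by
    funext x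
    simp only [Function.comp_apply, Homeomorph.toMeasurableEquiv_coe, LinearIsometryEquiv.coe_toHomeomorph,
      LinearIsometryEquiv.symm_apply_apply]
  rw [hfun]
  -- step 2: to `ι → ℝ`
  have hmp2 : MeasurePreserving (MeasurableEquiv.toLp 2 (ι → ℝ)) volume volume := PiLp.volume_preserving_toLp ι
  rw [← hmp2.integrable_comp_emb (MeasurableEquiv.toLp 2 (ι → ℝ)).measurableEmbedding]
  have hfun2 : ((fun x : EuclideanSpace ℝ ι => F x * exp (-(U (x + ψ) + 1 / 2 * ((WithLp.ofLp x) ⬝ᵥ (M *ᵥ (WithLp.ofLp x)))))) ∘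
      (MeasurableEquiv.toLp 2 (ι → ℝ))) =
      fun z : ι → ℝ => gaussWeight M z • (exp (-U (WithLp.toLp 2 z + ψ)) * F (WithLp.toLp 2 z)) := by
    funext z
    simp only [Function.comp_apply, MeasurableEquiv.coe_toLp, smul_eq_mul]
    rw [neg_add, exp_add, gaussWeight]
    ring
  rw [hfun2]
  -- step 3: the Gaussian weight as the density of `gaussProb M`, which is the image of `N(0,M⁻¹)`
  have hmeas : Measurable fun z : ι → ℝ => ENNReal.ofReal (gaussWeight M z) := (measurable_gaussWeight_real M).ennreal_ofReal
  have hgp : Integrable (fun z : ι → ℝ => exp (-U (WithLp.toLp 2 z + ψ)) * F (WithLp.toLp 2 z)) (gaussProb M) := by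
    rw [gaussProb_eq_map_multivariateGaussian hM, integrable_map_equiv]
    refine hF.congr (ae_of_all _ fun ω => ?_)
    simp only [Function.comp_apply, MeasurableEquiv.coe_toLp_symm, WithLp.toLp_ofLp]
  rw [gaussProb, integrable_smul_measure (by rw [ne_eq, ENNReal.ofReal_eq_zero, not_le]; exact inv_pos.2 hN) ENNReal.ofReal_ne_top,
    integrable_withDensity_iff_integrable_smul' hmeas (ae_of_all _ fun _ => ENNReal.ofReal_lt_top)] at hgp
  refine hgp.congr (ae_of_all _ fun z => ?_)
  simp only [ENNReal.toReal_ofReal (gaussWeight_pos M z).le]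

/-- **`e^{−V}` is integrable on `ℝⁿ`** (the case `F = 1` of the transfer, from the integrability of `e^{−U(·+ψ)}`). [folklore] -/
theorem exp_neg_V_integrable (hM : M.PosDef) (e : EuclideanSpace ℝ ι ≃ₗᵢ[ℝ] EuclideanSpace ℝ (Fin n)) (ψ : EuclideanSpace ℝ ι)
    (hI : Integrable (fun ω : EuclideanSpace ℝ ι => exp (-U (ω + ψ))) (multivariateGaussian 0 M⁻¹)) :
    Integrable (fun y : EuclideanSpace ℝ (Fin n) =>
      exp (-(U (e.symm y + ψ) + 1 / 2 * ((WithLp.ofLp (e.symm y)) ⬝ᵥ (M *ᵥ (WithLp.ofLp (e.symm y))))))) := by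
  have h := tilted_integrable_transfer (U := U) hM e ψ (F := fun _ => (1 : ℝ)) (by simpa only [mul_one] using hI)
  simpa only [one_mul] using h

/-- **`∫e^{−V} = 𝒩_M·Z(ψ)`**. [folklore] -/
theorem integral_exp_neg_V (hM : M.PosDef) (e : EuclideanSpace ℝ ι ≃ₗᵢ[ℝ] EuclideanSpace ℝ (Fin n)) (ψ : EuclideanSpace ℝ ι) :
    ∫ y : EuclideanSpace ℝ (Fin n), exp (-(U (e.symm y + ψ) + 1 / 2 * ((WithLp.ofLp (e.symm y)) ⬝ᵥ (M *ᵥ (WithLp.ofLp (e.symm y)))))) =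
      gaussNorm M * ∫ ω : EuclideanSpace ℝ ι, exp (-U (ω + ψ)) ∂(multivariateGaussian 0 M⁻¹) := by
  have h := tilted_integral_transfer (U := U) hM e ψ (F := fun _ => (1 : ℝ))
  simp only [one_mul, mul_one] at h
  exact h

end Transfer

/-! ## §2. `V` is continuous, differentiable and first-order `(m−λ)`-uniformly convex -/

section Convexity

variable {M : Matrix ι ι ℝ} {m lam : ℝ} {U : EuclideanSpace ℝ ι → ℝ} {U' : EuclideanSpace ℝ ι → EuclideanSpace ℝ ι →L[ℝ] ℝ}

omit [DecidableEq ι] in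
/-- The quadratic form `x ↦ ⟨ofLp x, M ofLp x⟩` is differentiable on `ℝ^ι` (a finite sum of products of coordinates). [folklore] -/
theorem quadForm_differentiable (M : Matrix ι ι ℝ) :
    Differentiable ℝ fun x : EuclideanSpace ℝ ι => (WithLp.ofLp x) ⬝ᵥ (M *ᵥ (WithLp.ofLp x)) := by
  have hproj : ∀ i : ι, Differentiable ℝ fun x : EuclideanSpace ℝ ι => (WithLp.ofLp x) i := fun i =>
    (EuclideanSpace.proj i : EuclideanSpace ℝ ι →L[ℝ] ℝ).differentiable
  have e1 : (fun x : EuclideanSpace ℝ ι => (WithLp.ofLp x) ⬝ᵥ (M *ᵥ (WithLp.ofLp x))) =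
      fun x => ∑ i, (WithLp.ofLp x) i * ∑ j, M i j * (WithLp.ofLp x) j := by
    funext x; simp only [dotProduct, Matrix.mulVec]
  rw [e1]
  exact Differentiable.fun_sum fun i _ => (hproj i).mul (Differentiable.fun_sum fun j _ => (differentiable_const _).mul (hproj j))

omit [DecidableEq ι] in
/-- `V` is continuous (`U ∈ C¹`). [folklore] -/
theorem V_continuous (e : EuclideanSpace ℝ ι ≃ₗᵢ[ℝ] EuclideanSpace ℝ (Fin n)) (hUd : ∀ φ : EuclideanSpace ℝ ι, HasFDerivAt U (U' φ) φ)
    (ψ : EuclideanSpace ℝ ι) :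
    Continuous fun y : EuclideanSpace ℝ (Fin n) =>
      U (e.symm y + ψ) + 1 / 2 * ((WithLp.ofLp (e.symm y)) ⬝ᵥ (M *ᵥ (WithLp.ofLp (e.symm y)))) := by
  have hUc : Continuous U := continuous_iff_continuousAt.2 fun φ => (hUd φ).continuousAt
  have hs : Continuous fun y : EuclideanSpace ℝ (Fin n) => e.symm y := e.symm.continuous
  exact (hUc.comp (hs.add continuous_const)).add (continuous_const.mul ((quadForm_differentiable M).continuous.comp hs))

omit [DecidableEq ι] in
/-- `V` is differentiable everywhere. [folklore] -/
theorem V_differentiable (e : EuclideanSpace ℝ ι ≃ₗᵢ[ℝ] EuclideanSpace ℝ (Fin n)) (hUd : ∀ φ : EuclideanSpace ℝ ι, HasFDerivAt U (U' φ) φ)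
    (ψ : EuclideanSpace ℝ ι) :
    Differentiable ℝ fun y : EuclideanSpace ℝ (Fin n) =>
      U (e.symm y + ψ) + 1 / 2 * ((WithLp.ofLp (e.symm y)) ⬝ᵥ (M *ᵥ (WithLp.ofLp (e.symm y)))) := by
  have hUdiff : Differentiable ℝ U := fun φ => (hUd φ).differentiableAt
  have hs : Differentiable ℝ fun y : EuclideanSpace ℝ (Fin n) => e.symm y := e.symm.toContinuousLinearEquiv.differentiable
  exact (hUdiff.comp (hs.add (differentiable_const ψ))).add ((differentiable_const _).mul ((quadForm_differentiable M).comp hs))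

omit [DecidableEq ι] in
/-- **THE SECANT LETTER OF `V`** with modulus `m − λ`: the secant lower letter `λ` of `U` (all sites) and the floor `m` of `M ≻ 0` give, for
`0 ≤ s ≤ 1` and all `x, y ∈ ℝⁿ`, `V((1−s)x + sy) + ½(m−λ)·s(1−s)·‖x−y‖² ≤ (1−s)V(x) + sV(y)`. [folklore] -/
theorem V_secant (hM : M.PosDef) (hfl : ∀ z : ι → ℝ, m * ∑ i, z i ^ 2 ≤ z ⬝ᵥ (M *ᵥ z))
    (e : EuclideanSpace ℝ ι ≃ₗᵢ[ℝ] EuclideanSpace ℝ (Fin n)) (hlam : 0 ≤ lam)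
    (hUsec : ∀ s : ℝ, 0 ≤ s → s ≤ 1 → ∀ a b : EuclideanSpace ℝ ι,
      U ((1 - s) • a + s • b) - lam / 2 * (s * (1 - s)) * ∑ i, (a i - b i) ^ 2 ≤ (1 - s) * U a + s * U b)
    (ψ : EuclideanSpace ℝ ι) {s : ℝ} (hs0 : 0 ≤ s) (hs1 : s ≤ 1) (x y : EuclideanSpace ℝ (Fin n)) :
    U (e.symm ((1 - s) • x + s • y) + ψ) + 1 / 2 * ((WithLp.ofLp (e.symm ((1 - s) • x + s • y))) ⬝ᵥ (M *ᵥ (WithLp.ofLp (e.symm ((1 - s) • x + s • y))))) +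
        (m - lam) / 2 * (s * (1 - s)) * ‖x - y‖ ^ 2 ≤
      (1 - s) * (U (e.symm x + ψ) + 1 / 2 * ((WithLp.ofLp (e.symm x)) ⬝ᵥ (M *ᵥ (WithLp.ofLp (e.symm x))))) +
        s * (U (e.symm y + ψ) + 1 / 2 * ((WithLp.ofLp (e.symm y)) ⬝ᵥ (M *ᵥ (WithLp.ofLp (e.symm y))))) := by
  have _ := hlam
  set a : EuclideanSpace ℝ ι := e.symm x with ha
  set b : EuclideanSpace ℝ ι := e.symm y with hb
  have hab : e.symm ((1 - s) • x + s • y) = (1 - s) • a + s • b := by rw [map_add, map_smul, map_smul]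
  rw [hab]
  -- the quadratic form's secant with floor `m`
  have hq := quadForm_secant (transpose_eq_of_posSemidef hM.posSemidef) hfl (WithLp.ofLp a) (WithLp.ofLp b) hs0 hs1
  have eab : WithLp.ofLp ((1 - s) • a + s • b) = (1 - s) • WithLp.ofLp a + s • WithLp.ofLp b := by
    rw [WithLp.ofLp_add, WithLp.ofLp_smul, WithLp.ofLp_smul]
  rw [eab]
  -- the potential's secant at the shifted points
  have hU := hUsec s hs0 hs1 (a + ψ) (b + ψ)
  have e1 : (1 - s) • (a + ψ) + s • (b + ψ) = ((1 - s) • a + s • b) + ψ := by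
    rw [smul_add, smul_add]; module
  rw [e1] at hU
  have e2 : ∑ i, ((a + ψ) i - (b + ψ) i) ^ 2 = ∑ i, (WithLp.ofLp a i - WithLp.ofLp b i) ^ 2 :=
    Finset.sum_congr rfl fun i _ => by simp
  rw [e2] at hU
  -- the norm: `‖x − y‖² = Σ_i(a_i − b_i)²` (isometry)
  have hn : ‖x - y‖ ^ 2 = ∑ i, (WithLp.ofLp a i - WithLp.ofLp b i) ^ 2 := by
    have h1 : ‖x - y‖ = ‖a - b‖ := by rw [ha, hb, ← map_sub, LinearIsometryEquiv.norm_map]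
    rw [h1, EuclideanSpace.real_norm_sq_eq]
    exact Finset.sum_congr rfl fun i _ => by simp
  rw [hn]
  nlinarith [hq, hU, mul_nonneg hs0 (sub_nonneg.2 hs1)]

omit [DecidableEq ι] in
/-- **THE END — `V` IS FIRST-ORDER `(m−λ)`-UNIFORMLY CONVEX**, in the letter of the tree's Brascamp–Lieb theorem: for all `x, y ∈ ℝⁿ`,
`V(x) + ⟨∇V(x), y − x⟩ + ½(m−λ)‖y − x‖² ≤ V(y)` (the secant letter + differentiability, by `firstOrder_of_secant_hasFDerivAt'`). [folklore] -/
theorem V_firstOrder_convex (hM : M.PosDef) (hfl : ∀ z : ι → ℝ, m * ∑ i, z i ^ 2 ≤ z ⬝ᵥ (M *ᵥ z))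
    (e : EuclideanSpace ℝ ι ≃ₗᵢ[ℝ] EuclideanSpace ℝ (Fin n)) (hUd : ∀ φ : EuclideanSpace ℝ ι, HasFDerivAt U (U' φ) φ) (hlam : 0 ≤ lam)
    (hUsec : ∀ s : ℝ, 0 ≤ s → s ≤ 1 → ∀ a b : EuclideanSpace ℝ ι,
      U ((1 - s) • a + s • b) - lam / 2 * (s * (1 - s)) * ∑ i, (a i - b i) ^ 2 ≤ (1 - s) * U a + s * U b)
    (ψ : EuclideanSpace ℝ ι) (x y : EuclideanSpace ℝ (Fin n)) :
    (U (e.symm x + ψ) + 1 / 2 * ((WithLp.ofLp (e.symm x)) ⬝ᵥ (M *ᵥ (WithLp.ofLp (e.symm x))))) +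
        inner ℝ (gradient (fun y : EuclideanSpace ℝ (Fin n) =>
          U (e.symm y + ψ) + 1 / 2 * ((WithLp.ofLp (e.symm y)) ⬝ᵥ (M *ᵥ (WithLp.ofLp (e.symm y))))) x) (y - x) +
        (m - lam) / 2 * ‖y - x‖ ^ 2 ≤
      U (e.symm y + ψ) + 1 / 2 * ((WithLp.ofLp (e.symm y)) ⬝ᵥ (M *ᵥ (WithLp.ofLp (e.symm y)))) := by
  have hd := ((V_differentiable e hUd ψ (M := M)) x).hasFDerivAt
  rw [gradient, InnerProductSpace.toDual_symm_apply]
  refine firstOrder_of_secant_hasFDerivAt' (R := ‖y - x‖ ^ 2) hd fun s hs0 hs1 => ?_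
  have h := V_secant hM hfl e hlam hUsec ψ hs0.le hs1.le x y
  have ex : x + s • (y - x) = (1 - s) • x + s • y := by module
  rw [ex, norm_sub_rev y x]
  linarith

end Convexity

/-! ## §3. Toy -/

/-- Toy (§1): with `H = 0` both Lebesgue integrals vanish. -/
example : ∫ x : EuclideanSpace ℝ ι, (fun _ => (0 : ℝ)) x = ∫ z : ι → ℝ, (fun _ : EuclideanSpace ℝ ι => (0 : ℝ)) (WithLp.toLp 2 z) :=
  integral_euclid_transfer fun _ => 0

end Summit.QuantumFields.BalabanUV.T4Continuum.NE7b.SupTiltedTransfer
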